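import Literature.Probability.LatticeModels.DiscreteRectBoundaryTrace
import Literature.Probability.LatticeModels.FKTwoArcPartitionPolynomials
import Literature.Probability.RandomPlanarGeometry.ConformalRectangle
import Literature.Analysis.Potential.HarmonicMeasure
import HarnessLib

/-!
# The critical FK-Ising crossing probability of a discrete quadrilateral (Chelkak–Smirnov)

Topic `Literature/Probability/LatticeModels` (family `crit-ising`); a NAMED FACT (D-0014).
D. Chelkak, S. Smirnov, *Universality in the 2D Ising model and conformal invariance of fermionic
observables*, Invent. Math. 189 (2012) 515–580 = arXiv:0910.2045, §6:

> "Let `Ω^δ_◇` be a discrete quadrilateral, i.e. simply-connected discrete domain composed of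
> inner rhombi and boundary half-rhombi, with four marked boundary points `a^δ, b^δ, c^δ, d^δ` and
> alternating Dobrushin-type boundary conditions: `∂Ω^δ_◇` consists of two "white" arcs
> `a_w b_w`, `c_w d_w` and two "black" arcs `b_b c_b`, `d_b a_b`. In the random cluster language
> it means that the four arcs are wired/free/wired/free, and in the loop representation this
> creates two interfaces that end at the four marked points and can connect in two possible
> ways. … Let `P^δ := P(a^δ ↔ b^δ; c^δ ↔ d^δ)` denote the probability of the first event.
> **Theorem 6.1.** For all `r, R, t > 0` there exists `ε(δ) = ε(δ, r, R, t)` such that if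
> `B(0, r) ⊂ Ω^δ ⊂ B(0, R)` and either both `ω(0; Ω^δ; a^δ b^δ), ω(0; Ω^δ; c^δ d^δ)` or both
> `ω(0; Ω^δ; b^δ c^δ), ω(0; Ω^δ; d^δ a^δ)` are `≥ t` (i.e. quadrilateral `Ω^δ` has no
> neighboring small arcs), then `|P^δ - p(Ω^δ; a^δ, b^δ, c^δ, d^δ)| ≤ ε(δ) → 0` as `δ → 0`
> (uniformly with respect to the shape of `Ω^δ` and `◇^δ`), where `p` depends only on the
> conformal modulus of the quadrilateral `(Ω^δ; a^δ, b^δ, c^δ, d^δ)`. In particular, for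
> `u ∈ [0, 1]`, `p(ℍ; 0, 1-u, 1, ∞) = √(1 - √(1-u)) / (√(1 - √u) + √(1 - √(1-u)))`."

Here `ω(0; Ω^δ; ·)` is the (continuous) harmonic measure in the polygonal domain `Ω^δ` (loc. cit.
§4, before Thm. 4.3) and the probability refers to the critical FK-Ising LOOP measure of §2.1.1,
eq. (2.1): weight `√2^{#loops}` on the configurations of the inner rhombi (= primal edges, open or
closed), the black boundary half-rhombi being open primal boundary edges, the white ones open
dual boundary edges.

## This file: the square-lattice case, in the vocabulary of the tree

We state the theorem (`ChelkakSmirnov2012_fkIsingQuadrilateralCrossing`, a `def … : Prop`) for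
the rhombic lattice of the square lattice `δℤ²` (rhombi = the diamonds around the edges of `δℤ²`,
isoradial graph `Γ = δℤ²`, `Γ* = δ(ℤ + ½)²`; an arbitrary base point `z₀ ∈ ℂ` replaces `0`, which
the paper allows since translates of `δℤ²` are isoradial graphs) and for the following SUB-CLASS
of discrete quadrilaterals, presented as the discrete topological rectangles
`DiscreteRect.IsRect E d₀ n` of `FKIsingTopologicalRectangleCrossing.lean` (one boundary-tracing
orbit through all external darts, cut into four consecutive arcs of darts `0, 1, 2, 3`,
counter-clockwise): `DiscreteRect.IsCSQuadrilateral E d₀ n` = `IsRect` + `E` induced, pinch- and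
diagonal-contact-free, every edge on a face (so `⟨E⟩` is the 1-skeleton of a polyomino bounded by
a simple lattice polygon) + both black arcs non-degenerate. The arcs `0, 2` are BLACK (wired),
the arcs `1, 3` WHITE (free):
* white half-rhombi = the triangles `DiscreteRect.whiteHalfRhombus` at the external darts of the
  arcs `1, 3`; the primal edges walked by the trace inside a white arc are inner rhombi, whose
  outer halves `DiscreteRect.outerHalfRhombus` stick out of the union of faces; black half-rhombi =
  the inner halves of the edges `DiscreteRect.blackArrows` walked from the last dart of the
  preceding white arc to the first dart of the following one (they lie in faces). So the polygonal
  domain `Ω^δ` is `DiscreteRect.csDomain` = interior of (faces ∪ white collar); its marked points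
  are the lattice points `DiscreteRect.csCorner j` where the colour changes (the paper's
  `b_b, c_b, d_b, a_b`; each is joined to the white polyline by one boundary edge of `Λ`, loc. cit.
  §2.1.1: the last white half-rhombus before a black arc is attached along one side only); the
  black arcs `⊂ ∂Ω^δ` are the unions `DiscreteRect.blackArc` of the black edges and the white arcs
  the unions `DiscreteRect.whiteArc` of the bases of the white half-rhombi.
* The FK graph is `DiscreteRect.graph E` with the vertex sets `DiscreteRect.blackVerts 0, 2` of
  the two black arcs wired. By Euler's formula, for a configuration `ω` of this planar graph (black
  edges open), `#loops(ω) = |ω| + 2 k_sep(ω) - |V| - 2 + 1_{B₀ ↔ B₂}(ω)`, `k_sep` = clusters with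
  each black arc wired separately; with `k_sep = k_joint + 1 - 1_{B₀ ↔ B₂}`
  (`arcClusterCount_separate_eq`) the loop weight `√2^{#loops}` is
  `∝ √2^{|ω| + 2 k_joint(ω)} · (√2)^{-1_{B₀ ↔ B₂}}`. Since `P^δ` is the probability that the two
  BLACK arcs are joined by an open crossing (the interface from `a` ends at `b` iff the primal
  cluster it follows contains both `(da)` and `(bc)`), `P^δ = N(√2) / (N(√2) + √2 (Z(√2) - N(√2)))`
  — the LOOP-SYMMETRIC normalisation — with `Z = rcArcPolynomial ⟨E⟩ B₀ B₂ joint`,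
  `N = rcArcPolynomialIn ⟨E⟩ {B₀ ↔ B₂} B₀ B₂ joint` of `FKTwoArcPartitionPolynomials.lean` (edges
  inside a wired arc only contribute a common factor `1 + √2`). This is
  `DiscreteRect.csCrossingProb`.
* The modulus: for a conformal map `φ : ℍ → Ω^δ` with boundary values `csCorner j` at real points
  `x₀, x₁, x₂, x₃`, Cardy's cross-ratio `η = crossRatio x` (`ConformalRectangle.lean`) is a Möbius
  invariant of `(Ω^δ; corners)`; labelling the paper's `(a, b, c, d) = (corner 3, corner 0,
  corner 1, corner 2)` (white `(ab)` = arc 3, black `(bc)` = arc 0, …) one has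
  `crossRatio (x_a, x_b, x_c, x_d) = 1 - u` for `(ℍ; 0, 1-u, 1, ∞)` and
  `crossRatio (x_b, x_c, x_d, x_a) = 1 - (1 - u) = u`, so the limit is
  `fkIsingCrossingFunction (crossRatio x)` with the printed `p(ℍ; 0, 1-u, 1, ∞)` (`η → 0`: the
  wired arc `0` shrinks, `p → 0`; `η → 1`: the free arc `1` shrinks, `p → 1`).

Not here: isoradial graphs (TODO(general form)), slit/pinched discrete domains (excluded by
`IsCSQuadrilateral`), the sequential corollary Thm. 1.3, the identification with `rcMeasure`
probabilities (`measureReal_rcMeasure_selfDual`), non-vacuity lemmas (an `m × m` block of faces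
with its four sides as arcs satisfies `IsCSQuadrilateral`). Mathlib has no FK model, discrete
domains or crossing formulae.

## References
* [ChelkakSmirnov2012Ising] D. Chelkak, S. Smirnov, Invent. Math. 189 (2012), §2.1.1 eq. (2.1),
  §6 Thm. 6.1, Rem. 6.2 (held: arXiv:0910.2045; read §1.2, §2.1, §4, §6).
* [ChelkakDuminilCopinHongler2016] D. Chelkak, H. Duminil-Copin, C. Hongler, EJP 21 (2016) no. 5,
  §2.1 (discrete domains of `ℤ²`, the presentation `DiscreteRect.IsRect`).
* [Grimmett2006] G. Grimmett, *The Random-Cluster Model* (2006), §6.1 eq. (6.9) (self-duality).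
-/

noncomputable section

open Filter Polynomial
open scoped Topology

namespace Literature.Probability.LatticeModels

open Literature.Probability.RandomPlanarGeometry (ConformalEquiv crossRatio)
open Literature.Analysis.Potential (harmonicMeasure)

/-- **The Chelkak–Smirnov crossing function**
`p(u) = √(1 - √(1-u)) / (√(1 - √u) + √(1 - √(1-u)))`, `u ∈ [0, 1]`: the scaling limit of the
critical FK-Ising probability that the two wired sides of the quadrilateral `(ℍ; 0, 1-u, 1, ∞)`
(wired `(1-u, 1)` and `(∞, 0)`, free in between) are joined by an open crossing; `p(0) = 0`,
`p(1) = 1`, `p(1-u) = 1 - p(u)` (Rem. 6.2). Junk outside `[0, 1]` (`Real.sqrt` vanishes on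
negatives). [cite: ChelkakSmirnov2012Ising, Thm. 6.1 eq. (6.1)] -/
def fkIsingCrossingFunction (u : ℝ) : ℝ :=
  Real.sqrt (1 - Real.sqrt (1 - u)) /
    (Real.sqrt (1 - Real.sqrt u) + Real.sqrt (1 - Real.sqrt (1 - u)))

namespace DiscreteRect

variable (E : Finset (Sym2 (Site 2))) (d₀ : Site 2 × Fin 4) (n : Fin 4 → ℕ)

/-! ### Combinatorics of the four arcs of a presented rectangle `(E, d₀, n)` -/

/-- The external darts of the `j`-th arc of the boundary cycle: positions `[lo n j, lo n j + n j)`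
(so `arcVerts E d₀ n j` is the set of their base vertices). For `j = 1, 3` these are the WHITE
boundary half-rhombi of the discrete quadrilateral. [cite: ChelkakSmirnov2012Ising, §2.1.1, §6] -/
def arcDarts (j : Fin 4) : Finset (Site 2 × Fin 4) :=
  (Finset.Ico (lo n j) (lo n j + n j)).image fun i ↦ (succ E)^[i] d₀

/-- The arrows walked by the boundary trace strictly inside the `j`-th arc (segments from the
dart at position `i` to the next one, both in arc `j`). For a white arc `j = 1, 3` these primal
edges are inner rhombi of the discrete quadrilateral, sticking out of the union of faces by their
outer halves. [cite: ChelkakSmirnov2012Ising, §2.1.1, §6] -/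
def innerArrows (j : Fin 4) : Finset (Site 2 × Fin 4) :=
  (Finset.Ico (lo n j) (lo n j + n j - 1)).biUnion fun i ↦ slots E ((succ E)^[i] d₀)

/-- **The black boundary edges of the arc `j` (`j = 0, 2`)**, as arrows walked by the trace: the
segments from the last dart of the preceding (white) arc up to and including the segment of the
last dart of arc `j` (positions `lo n j - 1, …, lo n j + n j - 1`, written with a shift by the
period `N = n 0 + n 1 + n 2 + n 3`, harmless under `IsRect.periodic`). These are the black boundary
half-rhombi `(b_b c_b)`, resp. `(d_b a_b)`; they are open. [cite: ChelkakSmirnov2012Ising, §6] -/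
def blackArrows (j : Fin 4) : Finset (Site 2 × Fin 4) :=
  (Finset.Ico (lo n j + (n 0 + n 1 + n 2 + n 3) - 1)
      (lo n j + (n 0 + n 1 + n 2 + n 3) + n j)).biUnion fun i ↦ slots E ((succ E)^[i] d₀)

/-- **The wired vertex set of the black arc `j` (`j = 0, 2`)**: the endpoints of its black edges
(together with the dart bases `arcVerts E d₀ n j`, which they contain unless the arc is
degenerate). It contains the concave corners of the black polyline, which carry no external dart.
[cite: ChelkakSmirnov2012Ising, §6] -/
def blackVerts (j : Fin 4) : Set (Site 2) :=
  {x | ∃ a ∈ blackArrows E d₀ n j, x = a.1 ∨ x = a.1 + dir a.2} ∪ arcVerts E d₀ n j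

/-- **The marked lattice points** of the discrete quadrilateral: `csCorner j` is the base of the
last dart of the white arc `j - 1` for `j = 0, 2` (where the black polyline of arc `j` starts: the
paper's `b_b`, `d_b`) and the base of the first dart of the white arc `j` for `j = 1, 3` (where the
black polyline ends: `c_b`, `a_b`). [cite: ChelkakSmirnov2012Ising, §2.1.1, §6] -/
def csCorner (j : Fin 4) : Site 2 :=
  ((succ E)^[if Even (j : ℕ) then lo n j + (n 0 + n 1 + n 2 + n 3) - 1 else lo n j] d₀).1

/-- **Square-lattice discrete quadrilaterals à la Chelkak–Smirnov** (the sub-class stated here):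
a presented discrete topological rectangle `IsRect E d₀ n` (CDH16 §2.1: one boundary cycle, four
arcs) whose edge set is INDUCED (two lattice-adjacent vertices of the domain are joined — no
slits), every edge of which borders a face (no whiskers or bridges), without pinch vertices (faces
in two opposite quadrants only) and without diagonal contacts (an exterior square met at two
opposite corners only), so that the union of its closed faces is a polyomino bounded by a simple
lattice polygon traced once, counter-clockwise, by the boundary cycle; and both black arcs walk
at least one edge (the four marked corners are distinct). TODO(general form): isoradial graphs;
slit, pinched and non-induced rhombic domains.
[cite: ChelkakSmirnov2012Ising, §6 (discrete quadrilaterals)] -/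
structure IsCSQuadrilateral : Prop where
  /-- One boundary cycle through all external darts, cut into four arcs (CDH16 §2.1). -/
  isRect : IsRect E d₀ n
  /-- Induced: lattice-adjacent vertices of the domain are joined by an edge (no slits). -/
  induced : ∀ x ∈ verts E, ∀ k : Fin 4, x + dir k ∈ verts E → s(x, x + dir k) ∈ E
  /-- Every edge is a side of a face (no whiskers, no bridges). -/
  edge_face : ∀ a ∈ arrows E, InF E (lsq a) ∨ InF E (rsq a)
  /-- No pinch vertex: faces in two opposite quadrants force a face in between. -/
  noPinch : ∀ x ∈ verts E, ∀ k : Fin 4, InF E (quad x k) → InF E (quad x (k + 2)) →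
    InF E (quad x (k + 1)) ∨ InF E (quad x (k + 3))
  /-- No diagonal contact: a unit square met at two opposite corners is met at a third one. -/
  noDiagonal : ∀ x ∈ verts E, ∀ k : Fin 4, x + dir k + dir (k + 1) ∈ verts E →
    x + dir k ∈ verts E ∨ x + dir (k + 1) ∈ verts E
  /-- Both black arcs walk at least one edge (the four corners are distinct). -/
  black_nonempty : (blackArrows E d₀ n 0).Nonempty ∧ (blackArrows E d₀ n 2).Nonempty

/-! ### The polygonal domain `Ω^δ` at mesh `δ` -/

/-- The centre of the unit square with lower-left corner `s`, at mesh `δ` (a vertex of the dual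
lattice `Γ* = δ(ℤ + ½)²`). [cite: ChelkakSmirnov2012Ising, §1.2] -/
def sqCentre (δ : ℝ) (s : Site 2) : ℂ :=
  meshPoint δ s + ((δ / 2 : ℝ) : ℂ) * (1 + Complex.I)

/-- The closed unit square (face) with lower-left corner `s`, at mesh `δ`. [folklore] -/
def closedSq (δ : ℝ) (s : Site 2) : Set ℂ :=
  convexHull ℝ (Set.range fun j : Fin 4 ↦ meshPoint δ (corner s j))

/-- The outer half-rhombus of the arrow `a = (p, m)`: the closed triangle with vertices `δp`,
`δ(p + e_m)` and the centre of the square to the RIGHT of `a` (the exterior side along the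
boundary trace). [cite: ChelkakSmirnov2012Ising, §2.1.1] -/
def outerHalfRhombus (δ : ℝ) (a : Site 2 × Fin 4) : Set ℂ :=
  convexHull ℝ {meshPoint δ a.1, meshPoint δ (a.1 + dir a.2), sqCentre δ (rsq a)}

/-- The white boundary half-rhombus of the external dart `d = (x, k)`: the closed triangle with
apex `δx` and base the dual edge joining the centres of the two squares flanking the missing
edge `x, x + e_k`. [cite: ChelkakSmirnov2012Ising, §2.1.1] -/
def whiteHalfRhombus (δ : ℝ) (d : Site 2 × Fin 4) : Set ℂ :=
  convexHull ℝ {meshPoint δ d.1, sqCentre δ (lsq d), sqCentre δ (rsq d)}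

/-- The closed polygon of the discrete quadrilateral at mesh `δ`: the union of its closed faces,
of the outer half-rhombi of the edges walked inside the white arcs `1, 3`, and of the white
half-rhombi at the darts of the white arcs. [cite: ChelkakSmirnov2012Ising, §6 (Ω^δ_◇)] -/
def csClosure (δ : ℝ) : Set ℂ :=
  (⋃ s ∈ faces E, closedSq δ s) ∪
    (⋃ a ∈ innerArrows E d₀ n 1 ∪ innerArrows E d₀ n 3, outerHalfRhombus δ a) ∪
    (⋃ d ∈ arcDarts E d₀ n 1 ∪ arcDarts E d₀ n 3, whiteHalfRhombus δ d)

/-- **The polygonal domain `Ω^δ ⊆ ℂ`** of the discrete quadrilateral at mesh `δ`: the interior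
of `csClosure`. [cite: ChelkakSmirnov2012Ising, §6 and §4 (the polygonal domain Ω^δ)] -/
def csDomain (δ : ℝ) : Set ℂ :=
  interior (csClosure E d₀ n δ)

/-- The black boundary arc `j` (`j = 0, 2`) of `∂Ω^δ` as a point set: the union of the black
edges. [cite: ChelkakSmirnov2012Ising, §6] -/
def blackArc (δ : ℝ) (j : Fin 4) : Set ℂ :=
  ⋃ a ∈ blackArrows E d₀ n j, segment ℝ (meshPoint δ a.1) (meshPoint δ (a.1 + dir a.2))

/-- The white boundary arc `j` (`j = 1, 3`) of `∂Ω^δ` as a point set: the union of the bases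
(dual edges) of the white half-rhombi. [cite: ChelkakSmirnov2012Ising, §6] -/
def whiteArc (δ : ℝ) (j : Fin 4) : Set ℂ :=
  ⋃ d ∈ arcDarts E d₀ n j, segment ℝ (sqCentre δ (rsq d)) (sqCentre δ (lsq d))

/-! ### The crossing probability in the loop-symmetric normalisation -/

open scoped Classical in
/-- **`P^δ = P(a ↔ b; c ↔ d)`**, the critical FK-Ising loop-measure probability that the two
black (wired) arcs `0` and `2` are joined by an open crossing, written over the self-dual
generating polynomials of `⟨E⟩` at `t = √2` with the black vertex sets `B₀, B₂` jointly wired: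
`N(√2) / (N(√2) + √2 (Z(√2) - N(√2)))`, `Z = Σ_ω t^{|ω| + 2k}`, `N` = its restriction to the
crossing event `{B₀ ↔ B₂}` (Euler's formula turns the loop weight `√2^{#loops}` into
`t^{|ω| + 2 k_joint} t^{-1_{B₀ ↔ B₂}}`, see the module docstring). Does not depend on `δ`.
[cite: ChelkakSmirnov2012Ising, §6 (P^δ) and §2.1.1 eq. (2.1)] -/
def csCrossingProb : ℝ :=
  let B₀ : Set ↥((verts E : Finset (Site 2)) : Set (Site 2)) := {x | x.1 ∈ blackVerts E d₀ n 0}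
  let B₂ : Set ↥((verts E : Finset (Site 2)) : Set (Site 2)) := {x | x.1 ∈ blackVerts E d₀ n 2}
  let N : ℝ := aeval (Real.sqrt 2) (rcArcPolynomialIn (graph E) (arcCrossing B₀ B₂) B₀ B₂ .joint)
  let Z : ℝ := aeval (Real.sqrt 2) (rcArcPolynomial (graph E) B₀ B₂ .joint)
  N / (N + Real.sqrt 2 * (Z - N))

end DiscreteRect

/-- **Chelkak–Smirnov 2012, Theorem 6.1 (square lattice): the crossing probability of the
critical FK-Ising model in a discrete quadrilateral.** For all `r, R, t > 0` there is
`ε(δ) = ε(δ, r, R, t) → 0` as `δ → 0⁺` such that for every mesh `δ > 0`, every square-lattice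
discrete quadrilateral (`DiscreteRect.IsCSQuadrilateral E d₀ n`: arcs `0, 2` wired = black, arcs
`1, 3` free = white) and every base point `z₀` with `B(z₀, r) ⊆ Ω^δ ⊆ B(z₀, R)`
(`Ω^δ = DiscreteRect.csDomain E d₀ n δ`, the polygonal domain) whose two black arcs, or whose two
white arcs, both have harmonic measure `≥ t` seen from `z₀` ("no neighbouring small arcs";
`Literature.Analysis.Potential.harmonicMeasure`), and for every conformal map `φ : ℍ → Ω^δ` with
boundary values the four marked corners `δ · csCorner j` at real points `x₀, x₁, x₂, x₃` (in
monotone order), the loop-measure probability `P^δ` that the two wired arcs are joined by an open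
FK crossing (`DiscreteRect.csCrossingProb`, `= N/(N + √2 (Z - N))`) satisfies
`|P^δ - p(crossRatio x)| ≤ ε(δ)`, `p = fkIsingCrossingFunction` (the printed `p(ℍ; 0, 1-u, 1, ∞)`
with `u = crossRatio x`, see the module docstring for the relabelling). Uniform in the shape of
the quadrilateral. Stated for `Γ = δℤ²` and the polyomino sub-class `IsCSQuadrilateral` only —
TODO(general form): isoradial graphs / rhombic lattices with angles in `[η, π - η]`, general
(slit, pinched) simply connected rhombic domains. Named fact, not proved here (printed proof:
s-holomorphic four-point observables, the boundary modification trick and Carathéodory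
compactness, loc. cit. §6). [cite: ChelkakSmirnov2012Ising, Thm. 6.1] -/
def ChelkakSmirnov2012_fkIsingQuadrilateralCrossing : Prop :=
  ∀ r R t : ℝ, 0 < r → 0 < R → 0 < t →
    ∃ ε : ℝ → ℝ, Tendsto ε (𝓝[>] 0) (𝓝 0) ∧
      ∀ (δ : ℝ) (E : Finset (Sym2 (Site 2))) (d₀ : Site 2 × Fin 4) (n : Fin 4 → ℕ) (z₀ : ℂ),
        0 < δ → DiscreteRect.IsCSQuadrilateral E d₀ n →
        let U : Set ℂ := DiscreteRect.csDomain E d₀ n δ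
        Metric.ball z₀ r ⊆ U → U ⊆ Metric.ball z₀ R →
        (t ≤ harmonicMeasure U z₀ (DiscreteRect.blackArc E d₀ n δ 0) ∧
            t ≤ harmonicMeasure U z₀ (DiscreteRect.blackArc E d₀ n δ 2) ∨
          t ≤ harmonicMeasure U z₀ (DiscreteRect.whiteArc E d₀ n δ 1) ∧
            t ≤ harmonicMeasure U z₀ (DiscreteRect.whiteArc E d₀ n δ 3)) →
        ∀ (φ : ConformalEquiv UpperHalfPlane.upperHalfPlaneSet U) (x : Fin 4 → ℝ),
          (StrictMono x ∨ StrictAnti x) →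
          (∀ j : Fin 4, φ.HasBoundaryValue (x j) (meshPoint δ (DiscreteRect.csCorner E d₀ n j))) →
          |DiscreteRect.csCrossingProb E d₀ n - fkIsingCrossingFunction (crossRatio x)| ≤ ε δ

end Literature.Probability.LatticeModels

end
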